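import Summits.QuantumFields.BalabanUV.T4Continuum.Spine.NE3.PairFrameCondition
import HarnessLib

/-!
# T⁴ programme, node NE3 — census R50 AT ONE LEVEL: THE FRAME NORMALISATION OF [Balaban1985Averaging] (58)–(63) — the double-bar average is COVARIANT under
# block-covariantly-constant moving-frame gauges, and the gauge `u := ṽ·u₀`, `ṽ` = the block-covariantly-constant extension of the block frames of the perturbation,
# satisfies the frame condition `v_1(U′) = u_1`, hence (1.37) at a level-1 pair (`FrameNormalisationOneLevel`)

Cell `pub-balaban-gaps` (track G2, seat ne3, generation 11), row NE3; census `HOME/ne/NE3.md` §4 R50, §17.  After `PairFrameCondition` (R49: at the pair, (1.37)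
`U̿′ᵏ = 1` ⟺ the coarse frame gauge `g = u_k⁻¹·v_k(U′)` stabilises the datum; sufficient `v_k(U′) = u_k`), the question is how to PRODUCE a gauge meeting the frame
condition.  [Balaban1985Averaging] pp. 27–28 does it at one level: from the block axial gauge, «we apply a gauge transformation v⁻¹ to V′ and we get a configuration V₁,
thus V′ = V₁^v» with `v` THE BLOCK FRAME (62).  This module types that mechanism on the tree's objects (`B7Eq92Concrete.{tHol, Fcov, wframe, dbavgCov, vcov, mgauge}`):

* §1 COVARIANCE UNDER BLOCK-COVARIANTLY-CONSTANT GAUGES.  Call `v` block-covariantly constant on the block of `y` (relative to `V₀`) when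
  `R(V₀(Γ_{y,x})) v(x) = v(y)` for every `x = y + r` of the block (the printed «(R_{0,y}v)(x) = v(y)», (60) with `V₁ = 1`) — a HYPOTHESIS, no definition.  Then the
  twisted holonomies CONJUGATE (`tHol_mgauge_of_blockCovConst`, from `tHol_mgauge` (58)–(60)), so do the exponent (62) and the block frame (82)
  (`Fcov_mgauge_of_blockCovConst`, `wframe_mgauge_of_blockCovConst`: `w(V₁^{v})(y) = v(y)·w(V₁)(y)·v(y)⁻¹`, by `mlog_Rc` ∕ `expUnit_conj` (57)), and the ONE-STEP DOUBLE-BAR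
  AVERAGE (89) IS MOVING-FRAME COVARIANT: `(V₁^{v})‾‾(c) = v(c₋)·V̿₁(c)·[R(V̄₀(c)) v(c₊)]⁻¹` (`dbavgCov_mgauge_of_blockCovConst`).  (For intra-block gauges — e.g. `e^{λ}`,
  `λ ∈ N(Q′(W))` — no such law holds: the block frame is a NONLINEAR block mean.)
* §2 `exists_blockCovConst_extension` — every corner datum `c` extends to a block-covariantly-constant site gauge `ṽ` with `ṽ(Lz) = c(Lz)`
  (`ṽ(Lz + r) := W(Γ_{Lz,Lz+r})⁻¹·c(Lz)·W(Γ_{Lz,Lz+r})`).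
* §3 THE FRAME NORMALISATION AT LEVEL 1 (`frameCondition_one_level`, **`dbavgCovIter_one_eq_one_of_pair`**): `u₀` any gauge trivial at the block corners
  (`u₀(Lz) = 1`), `U_A^{u₀} = U₀′·W`; `ṽ` block-covariantly constant with corner values the block frames `w(U₀′)(Lz)`; `u := ṽ·u₀`, `U′ := U₀′^{ṽ}` (moving frame (55),
  so `U_A^{u} = U′·W`).  Then **`vcov L W U′ 1 = uLev L u 1`** — the frame condition of R49 at `k = 1` — and therefore, at a level-1 pair (`Ū_A = V = W̄`),
  **`dbavgCovIter L W U′ 1 = 1`**: (1.37) HOLDS for the frame-normalised gauge.  (R49's `avgIter_eq_of_rep` is re-derived for a general start-frame perturbation `U′`,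
  `avgIter_eq_of_rep'`, so that no logarithm is needed.)

WHAT THIS IS NOT.  One level only (`k = 1`): the `k`-level normalisation is [Balaban1985Averaging] (96)–(99) (the accumulated frame `v_k` = the recursive block averages
(85), tree `B7Eq99Concrete.wrec_eq_vcov`) and needs a HIERARCHICALLY block-covariantly-constant gauge — census R50 proper, not built here; and the normalisation is NOT yet
run jointly with the (1.38)-Landau step (the owner lineage's brick E′), which intra-block gauges break at second order.  Nothing of Bałaban's is asserted: the identities are
OUR readings of (55)–(63)∕(89) on the tree's formal objects (no smallness, no unitarity used in §1–§3).  **NE3 NOT proved**; spine PROVED 0∕9; finite T⁴ rung (B)+1 — NOT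
continuum YM on ℝ⁴, NOT infinite volume, NOT mass gap, NOT `BetaPertH`, NOT Clay.  HONEST DEPENDENCY: continuum YM on T⁴ ⇐ BetaPertH ∧ nine spine estimates (0/9 proved);
BetaPertH ⇐ (D1) ∧ (D4) ∧ CAP+tail; G-an2-4 gates asym, D1 and NE2/3/4.  PLACEMENT: `Summits/QuantumFields/BalabanUV/T4Continuum/Spine/NE3/`; imports `PairFrameCondition` only.

References: [Balaban1985Averaging] T. Bałaban, *Averaging operations for lattice gauge theories*, CMP 98 (1985) 17–51: (55)–(63) pp. 27–28, (82) p. 30, (89)–(92) p. 31,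
(96)–(99) p. 32; [Balaban1985RegularSpaces] CMP 99 (1985), (1.29) p. 80, (1.37) p. 82.
-/

set_option autoImplicit false

open scoped BigOperators Matrix Matrix.Norms.L2Operator
open NormedSpace

namespace Summit.QuantumFields.BalabanUV.T4Continuum.NE3.FrameNormalisationOneLevel

open Literature.MathematicalPhysics.QuantumFieldTheory.Balaban1983to89
open B7Prop1Explicit B7Prop2Explicit MatrixLog
open B7AvgGaugeCovariance (uLev)
open B7Prop6Flat (avgIter_gaugeAct_units)
open B7Eq92Concrete (Rc Rc_apply mgauge mgauge_apply mgauge_mul tHol tHol_mgauge Fcov wframe tild tild_mgauge dbavgCov dbavgCov_apply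
  dbavgCovIter dbavgCovIter_zero vcov vcov_zero vcov_succ avgIter_mul_eq_gaugeAct mlog_Rc expUnit_conj)
open B8Eq115GaugeFixing (gaugeAct_mul)
open B8Ineq130 (gaugeAct_one)
open NE3.PairFrameCondition (gaugeAct_inv_gaugeAct gaugeAct_injective)

noncomputable section

variable {d : ℕ} {n : Type*} [Fintype n] [DecidableEq n]

/-! ## §1 Covariance of the twisted holonomy, the block frame and the one-step double-bar average under block-covariantly-constant gauges -/

/-- **TWISTED HOLONOMIES CONJUGATE** under a moving-frame gauge `v` that is block-covariantly constant on the block of `y` along the contour `Γ`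
(`R(V₀(Γ)) v(y + disp Γ) = v(y)`, the printed «(R_{0,y}v)(x) = v(y)»): `(R_{0,y}V₁^{v})(Γ) = v(y)·(R_{0,y}V₁)(Γ)·v(y)⁻¹` ([Balaban1985Averaging] (58)–(60)). [folklore] -/
theorem tHol_mgauge_of_blockCovConst (V₀ V₁ : Site d → Fin d → (Matrix n n ℂ)ˣ) (v : Site d → (Matrix n n ℂ)ˣ) (y : Site d) (w : List (Letter d))
    (hv : Rc (hol V₀ y w) (v (y + disp w)) = v y) :
    tHol V₀ (mgauge V₀ v V₁) y w = Rc (v y) (tHol V₀ V₁ y w) := by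
  rw [tHol_mgauge, hv, Rc_apply]

/-- **THE EXPONENT (62) CONJUGATES**: if `v` is block-covariantly constant on the whole block of `y` (every tree contour `Γ_{y,y+r}`), then
`F(V₁^{v})(y) = v(y)·F(V₁)(y)·v(y)⁻¹` (`mlog_Rc`: the series logarithm is conjugation-covariant, (57)). [folklore] -/
theorem Fcov_mgauge_of_blockCovConst (L : ℕ) (V₀ V₁ : Site d → Fin d → (Matrix n n ℂ)ˣ) (v : Site d → (Matrix n n ℂ)ˣ) (y : Site d)
    (hv : ∀ r : Fin d → Fin L, Rc (hol V₀ y (treeWord (boxVec L r))) (v (y + boxVec L r)) = v y) :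
    Fcov L V₀ (mgauge V₀ v V₁) y = (v y : (Matrix n n ℂ)) * Fcov L V₀ V₁ y * ((v y)⁻¹ : (Matrix n n ℂ)ˣ) := by
  unfold Fcov
  rw [Finset.mul_sum, Finset.sum_mul]
  refine Finset.sum_congr rfl fun r _ => ?_
  have hv' : Rc (hol V₀ y (treeWord (boxVec L r))) (v (y + disp (treeWord (boxVec L r)))) = v y := by
    rw [disp_treeWord]; exact hv r
  rw [tHol_mgauge_of_blockCovConst V₀ V₁ v y _ hv', mlog_Rc, ← smul_mul_assoc, ← mul_smul_comm]

/-- **THE BLOCK FRAME (82) CONJUGATES**: `w(V₁^{v})(y) = v(y)·w(V₁)(y)·v(y)⁻¹` for `v` block-covariantly constant on the block of `y` (`expUnit_conj`, (57)). [folklore] -/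
theorem wframe_mgauge_of_blockCovConst (L : ℕ) (V₀ V₁ : Site d → Fin d → (Matrix n n ℂ)ˣ) (v : Site d → (Matrix n n ℂ)ˣ) (y : Site d)
    (hv : ∀ r : Fin d → Fin L, Rc (hol V₀ y (treeWord (boxVec L r))) (v (y + boxVec L r)) = v y) :
    wframe L V₀ (mgauge V₀ v V₁) y = Rc (v y) (wframe L V₀ V₁ y) := by
  unfold wframe
  rw [Fcov_mgauge_of_blockCovConst L V₀ V₁ v y hv, expUnit_conj]

/-- **THE ONE-STEP DOUBLE-BAR AVERAGE (89) IS MOVING-FRAME COVARIANT** under a gauge that is block-covariantly constant on the blocks of BOTH endpoints of the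
`L`-bond `c = ⟨q, q + Le_κ⟩`: `(V₁^{v})‾‾(c) = v(q) · V̿₁(c) · [R(V̄₀(c)) v(q + Le_κ)]⁻¹` — the moving-frame action (55) relative to the averaged background, read at the
corners.  (Group algebra over `tild_mgauge` (59)∕(93) and the frame covariance.) [folklore] -/
theorem dbavgCov_mgauge_of_blockCovConst (L : ℕ) (V₀ V₁ : Site d → Fin d → (Matrix n n ℂ)ˣ) (v : Site d → (Matrix n n ℂ)ˣ) (q : Site d) (κ : Fin d)
    (hq : ∀ r : Fin d → Fin L, Rc (hol V₀ q (treeWord (boxVec L r))) (v (q + boxVec L r)) = v q)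
    (hq' : ∀ r : Fin d → Fin L,
      Rc (hol V₀ (q + (L : ℤ) • e κ) (treeWord (boxVec L r))) (v (q + (L : ℤ) • e κ + boxVec L r)) = v (q + (L : ℤ) • e κ)) :
    dbavgCov L V₀ (mgauge V₀ v V₁) q κ
      = v q * dbavgCov L V₀ V₁ q κ * (Rc (bavg L V₀ q κ) (v (q + (L : ℤ) • e κ)))⁻¹ := by
  rw [dbavgCov_apply, dbavgCov_apply, wframe_mgauge_of_blockCovConst L V₀ V₁ v q hq,
    wframe_mgauge_of_blockCovConst L V₀ V₁ v _ hq', tild_mgauge]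
  simp only [Rc_apply, map_mul, map_inv, mul_inv_rev, inv_inv]
  group

/-! ## §2 Block-covariantly-constant extension of corner data -/

/-- The block decomposition of a site: `x = L•z + r`, `z = ⌊x∕L⌋`, `r = x mod L ∈ [0, L)^d`. [folklore] -/
theorem site_eq_corner_add_boxVec {L : ℕ} (hL : 1 ≤ L) (x : Site d) :
    ∃ (z : Site d) (r : Fin d → Fin L), x = (L : ℤ) • z + boxVec L r := by
  have hL0 : (0 : ℤ) < L := by exact_mod_cast hL
  have hlt : ∀ i, (x i % (L : ℤ)).toNat < L := by
    intro i
    have h1 : x i % (L : ℤ) < L := Int.emod_lt_of_pos _ hL0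
    have h0 : 0 ≤ x i % (L : ℤ) := Int.emod_nonneg _ hL0.ne'
    omega
  refine ⟨fun i => x i / (L : ℤ), fun i => ⟨(x i % (L : ℤ)).toNat, hlt i⟩, ?_⟩
  funext i
  simp only [Pi.add_apply, Pi.smul_apply, smul_eq_mul, boxVec]
  rw [Int.toNat_of_nonneg (Int.emod_nonneg _ hL0.ne')]
  have h := Int.emod_add_mul_ediv (x i) (L : ℤ)
  linarith

/-- Uniqueness of the block decomposition: `L•z + r = L•z′ + r′` forces `z = z′`, `r = r′`. [folklore] -/
theorem corner_boxVec_unique {L : ℕ} (hL : 1 ≤ L) {z z' : Site d} {r r' : Fin d → Fin L}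
    (h : (L : ℤ) • z + boxVec L r = (L : ℤ) • z' + boxVec L r') : z = z' ∧ r = r' := by
  have hL0 : (0 : ℤ) < L := by exact_mod_cast hL
  have hi : ∀ i, z i = z' i ∧ (r i : ℕ) = r' i := by
    intro i
    have hx := congrFun h i
    simp only [Pi.add_apply, Pi.smul_apply, smul_eq_mul, boxVec] at hx
    have hr : ((r i : ℕ) : ℤ) < L := by exact_mod_cast (r i).isLt
    have hr' : ((r' i : ℕ) : ℤ) < L := by exact_mod_cast (r' i).isLt
    have h1 : ((L : ℤ) * z i + r i) / L = z i := by
      rw [add_comm, Int.add_mul_ediv_left _ _ hL0.ne', Int.ediv_eq_zero_of_lt (by positivity) hr, zero_add]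
    have h2 : ((L : ℤ) * z' i + r' i) / L = z' i := by
      rw [add_comm, Int.add_mul_ediv_left _ _ hL0.ne', Int.ediv_eq_zero_of_lt (by positivity) hr', zero_add]
    have hz : z i = z' i := by rw [← h1, ← h2, hx]
    refine ⟨hz, ?_⟩
    rw [hz] at hx
    exact_mod_cast (add_left_cancel hx)
  exact ⟨funext fun i => (hi i).1, funext fun i => Fin.ext (hi i).2⟩

/-- **EVERY CORNER DATUM EXTENDS TO A BLOCK-COVARIANTLY-CONSTANT GAUGE** relative to `W`: there is `vt` with `vt(Lz) = c(Lz)` and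
`R(W(Γ_{Lz,Lz+r})) vt(Lz + r) = vt(Lz)` for every block `Lz` and offset `r` (namely `vt(Lz + r) = W(Γ_{Lz,Lz+r})⁻¹·c(Lz)·W(Γ_{Lz,Lz+r})`). [folklore] -/
theorem exists_blockCovConst_extension {L : ℕ} (hL : 1 ≤ L) (W : Site d → Fin d → (Matrix n n ℂ)ˣ) (c : Site d → (Matrix n n ℂ)ˣ) :
    ∃ vt : Site d → (Matrix n n ℂ)ˣ, (∀ z : Site d, vt ((L : ℤ) • z) = c ((L : ℤ) • z)) ∧
      ∀ (z : Site d) (r : Fin d → Fin L),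
        Rc (hol W ((L : ℤ) • z) (treeWord (boxVec L r))) (vt ((L : ℤ) • z + boxVec L r)) = vt ((L : ℤ) • z) := by
  classical
  -- choose the decomposition of every site
  have hdec := fun x : Site d => site_eq_corner_add_boxVec (d := d) hL x
  choose zOf rOf hzr using hdec
  have hzc : ∀ (z : Site d) (r : Fin d → Fin L), zOf ((L : ℤ) • z + boxVec L r) = z ∧ rOf ((L : ℤ) • z + boxVec L r) = r := by
    intro z r
    have h := hzr ((L : ℤ) • z + boxVec L r)
    have hu := corner_boxVec_unique (d := d) hL h.symm
    exact ⟨hu.1, hu.2⟩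
  have hz0 : ∀ z : Site d, zOf ((L : ℤ) • z) = z ∧ rOf ((L : ℤ) • z) = fun _ => ⟨0, hL⟩ := by
    intro z
    have hb : boxVec L (fun _ : Fin d => (⟨0, hL⟩ : Fin L)) = 0 := by funext i; simp [boxVec]
    have h := hzc z (fun _ => ⟨0, hL⟩)
    rw [hb, add_zero] at h
    exact h
  refine ⟨fun x => (hol W ((L : ℤ) • zOf x) (treeWord (boxVec L (rOf x))))⁻¹ * c ((L : ℤ) • zOf x) *
      hol W ((L : ℤ) • zOf x) (treeWord (boxVec L (rOf x))), ?_, ?_⟩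
  · intro z
    have hb : boxVec L (fun _ : Fin d => (⟨0, hL⟩ : Fin L)) = 0 := by funext i; simp [boxVec]
    simp only [(hz0 z).1, (hz0 z).2, hb, treeWord_zero, hol_nil, inv_one, one_mul, mul_one]
  · intro z r
    have hb : boxVec L (fun _ : Fin d => (⟨0, hL⟩ : Fin L)) = 0 := by funext i; simp [boxVec]
    simp only [(hzc z r).1, (hzc z r).2, (hz0 z).1, (hz0 z).2, hb, treeWord_zero, hol_nil, inv_one, one_mul, mul_one, Rc_apply]
    group

/-! ## §3 The frame normalisation at level 1 -/

/-- The accumulated frame (97) at order `1` is the block frame of the perturbation at the block corner: `v_1(U′)(z) = w(U′)(Lz)`. [folklore] -/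
theorem vcov_one (L : ℕ) (W U' : Site d → Fin d → (Matrix n n ℂ)ˣ) (z : Site d) : vcov L W U' 1 z = wframe L W U' ((L : ℤ) • z) := by
  rw [vcov_succ, vcov_zero, one_mul, avgIter_zero, dbavgCovIter_zero]

/-- **R49's `avgIter_eq_of_rep` FOR A GENERAL START-FRAME PERTURBATION** ([Balaban1985Averaging] (159) ∘ (11)): if `U_A^{u} = U′·W` then
`Ū_Aᵏ = (U̿′ᵏ·W̄ᵏ)^{g}`, `g = u_k⁻¹·v_k(U′)`. [folklore] -/
theorem avgIter_eq_of_rep' (L k : ℕ) {u : Site d → (Matrix n n ℂ)ˣ} {UA W U' : Site d → Fin d → (Matrix n n ℂ)ˣ} (hrep : gaugeAct u UA = U' * W) :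
    avgIter L UA k = gaugeAct (uLev L u⁻¹ k * vcov L W U' k) (dbavgCovIter L W U' k * avgIter L W k) := by
  have hUA : UA = gaugeAct u⁻¹ (U' * W) := by rw [← hrep, gaugeAct_inv_gaugeAct]
  rw [hUA, avgIter_gaugeAct_units, avgIter_mul_eq_gaugeAct, ← gaugeAct_mul]

/-- **(1.37) FROM THE FRAME CONDITION, GENERAL PERTURBATION, ANY ORDER**: at a pair with common average (`Ū_Aᵏ = V = W̄ᵏ`), `U_A^{u} = U′·W` and `v_k(U′) = u_k` give
`U̿′ᵏ = 1`. [folklore] -/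
theorem dbavgCovIter_eq_one_of_frame_eq' (L k : ℕ) {u : Site d → (Matrix n n ℂ)ˣ} {UA W U' V : Site d → Fin d → (Matrix n n ℂ)ˣ}
    (hrep : gaugeAct u UA = U' * W) (hA : avgIter L UA k = V) (hW : avgIter L W k = V) (hframe : vcov L W U' k = uLev L u k) :
    dbavgCovIter L W U' k = 1 := by
  have h := avgIter_eq_of_rep' L k hrep
  rw [hframe, NE3.PairFrameCondition.uLev_inv_mul, gaugeAct_one, hA, hW] at h
  have h2 : (1 : Site d → Fin d → (Matrix n n ℂ)ˣ) * V = dbavgCovIter L W U' k * V := by rw [one_mul]; exact h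
  exact (mul_right_cancel h2).symm

/-- **THE FRAME NORMALISATION AT LEVEL 1.**  `u₀` a gauge trivial at the block corners with `U_A^{u₀} = U₀′·W`; `vt` block-covariantly constant (relative to `W`) with corner values
the block frames of `U₀′`, `vt(Lz) = w(U₀′)(Lz)`; `u := vt·u₀`, `U′ := U₀′^{vt}` (moving frame).  Then `U_A^{u} = U′·W` and **`v_1(U′) = u_1`** — the frame condition of
`PairFrameCondition` at `k = 1` ([Balaban1985Averaging] (60)–(63): «V′ = V₁^{v}» with `v` the block frame). [folklore] -/
theorem frameCondition_one_level (L : ℕ) {u₀ vt : Site d → (Matrix n n ℂ)ˣ} {UA W U₀' : Site d → Fin d → (Matrix n n ℂ)ˣ}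
    (hrep₀ : gaugeAct u₀ UA = U₀' * W) (hu₀ : ∀ z : Site d, u₀ ((L : ℤ) • z) = 1)
    (hcorner : ∀ z : Site d, vt ((L : ℤ) • z) = wframe L W U₀' ((L : ℤ) • z))
    (hvt : ∀ (z : Site d) (r : Fin d → Fin L), Rc (hol W ((L : ℤ) • z) (treeWord (boxVec L r))) (vt ((L : ℤ) • z + boxVec L r)) = vt ((L : ℤ) • z)) :
    gaugeAct (vt * u₀) UA = mgauge W vt U₀' * W ∧ vcov L W (mgauge W vt U₀') 1 = uLev L (vt * u₀) 1 := by
  constructor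
  · rw [gaugeAct_mul, hrep₀, mgauge_mul]
  · funext z
    rw [vcov_one, wframe_mgauge_of_blockCovConst L W U₀' vt _ (hvt z), hcorner z, Rc_apply, mul_inv_cancel_right]
    simp only [uLev, pow_one, Pi.mul_apply, hu₀ z, mul_one]
    exact (hcorner z).symm

/-- **(1.37) AT A LEVEL-1 PAIR FOR THE FRAME-NORMALISED GAUGE**: with the data of `frameCondition_one_level` at a pair with `Ū_A¹ = V = W̄¹`, the one-step double-bar average
of the normalised perturbation is trivial: `dbavgCovIter L W (U₀′^{vt}) 1 = 1`. [folklore] -/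
theorem dbavgCovIter_one_eq_one_of_pair (L : ℕ) {u₀ vt : Site d → (Matrix n n ℂ)ˣ} {UA W U₀' V : Site d → Fin d → (Matrix n n ℂ)ˣ}
    (hrep₀ : gaugeAct u₀ UA = U₀' * W) (hu₀ : ∀ z : Site d, u₀ ((L : ℤ) • z) = 1)
    (hcorner : ∀ z : Site d, vt ((L : ℤ) • z) = wframe L W U₀' ((L : ℤ) • z))
    (hvt : ∀ (z : Site d) (r : Fin d → Fin L), Rc (hol W ((L : ℤ) • z) (treeWord (boxVec L r))) (vt ((L : ℤ) • z + boxVec L r)) = vt ((L : ℤ) • z))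
    (hA : avgIter L UA 1 = V) (hW : avgIter L W 1 = V) :
    dbavgCovIter L W (mgauge W vt U₀') 1 = 1 := by
  obtain ⟨hrep, hframe⟩ := frameCondition_one_level L hrep₀ hu₀ hcorner hvt
  exact dbavgCovIter_eq_one_of_frame_eq' L 1 hrep hA hW hframe

/-- **EXISTENCE FORM**: at a level-1 pair, for every gauge `u₀` trivial at the block corners with `U_A^{u₀} = U₀′·W` there is a gauge `u` (`= vt·u₀`) and a perturbation `U′`
(`= U₀′^{vt}`) with `U_A^{u} = U′·W`, the frame condition `v_1(U′) = u_1`, and (1.37) `U̿′¹ = 1` (`L ≥ 1`). [folklore] -/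
theorem exists_frameNormalised_one_level {L : ℕ} (hL : 1 ≤ L) {u₀ : Site d → (Matrix n n ℂ)ˣ} {UA W U₀' V : Site d → Fin d → (Matrix n n ℂ)ˣ}
    (hrep₀ : gaugeAct u₀ UA = U₀' * W) (hu₀ : ∀ z : Site d, u₀ ((L : ℤ) • z) = 1) (hA : avgIter L UA 1 = V) (hW : avgIter L W 1 = V) :
    ∃ (u : Site d → (Matrix n n ℂ)ˣ) (U' : Site d → Fin d → (Matrix n n ℂ)ˣ),
      gaugeAct u UA = U' * W ∧ vcov L W U' 1 = uLev L u 1 ∧ dbavgCovIter L W U' 1 = 1 := by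
  obtain ⟨vt, hc, hvt⟩ := exists_blockCovConst_extension hL W (wframe L W U₀')
  obtain ⟨hrep, hframe⟩ := frameCondition_one_level L hrep₀ hu₀ hc hvt
  exact ⟨vt * u₀, mgauge W vt U₀', hrep, hframe, dbavgCovIter_eq_one_of_frame_eq' L 1 hrep hA hW hframe⟩

end

end Summit.QuantumFields.BalabanUV.T4Continuum.NE3.FrameNormalisationOneLevel
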